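import Summits.ResolutionOfSingularities.ResolutionOfSingularities.Theorems.FrobeniusLadderFInjectiveMacaulayficationT11Char3Frame
import Summits.ResolutionOfSingularities.ResolutionOfSingularities.Theorems.FrobeniusLadderFInjectiveMacaulayficationMonomialChartPresentationKernel
import HarnessLib

/-!
# E7 — THE T₁₁/3 FRAME, Ψ-FORM: `T11Char3Frame.t11_originPointFixable_char3_of_data'` — as `…_of_data` (p537547) but the curve-data
# hypothesis `hR3` quantifies the chart presentations `θ c` with the C1-KERNEL clause `(θ_c q̄).val = Ψ_c q` for ALL `q`
# (res-type-034's `T11Char3R3Charts.ideal_closure_map_eq_of_data` binder `hθc` VERBATIM), instead of the θ-clause at the variables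
# (crux `FInjectiveMacaulayfication` stmt-ResolutionOfSingularities-15315, chain w45a; E7 T₁₁/3; θ-SPEC ALIGNMENT, STATUS 2026-08-27T14:52:47Z)

[OURS · L1 W4.5a · res-L1-w45a-lead-1 gen 5] Support file (`--supports stmt-ResolutionOfSingularities-15315 --as helper`); NOT a statement of
any manuscript; AI-written, weaker than expert review. The presentations are built inside from `MonomialChartPresentationKernel.exists_monomialChartPresentation`
(stub-1; `hunit` = `T11Char7Fan.hunit`), which delivers both the Ψ-clause (handed to `hR3`) and the θ-clause (used for the model fibre ideals). Everything else is
`…T11Char3Frame` verbatim (its §1 preliminaries are imported). No definitions, no named facts. [folklore glue]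
-/

-- single-problem summit: the doubled namespace component is forced
set_option linter.dupNamespace false

noncomputable section

namespace Summit.ResolutionOfSingularities.ResolutionOfSingularities.Theorems.FInjectiveMacaulayfication.T11Char3Frame

open AlgebraicGeometry CategoryTheory TopologicalSpace Literature.AlgebraicGeometry.Resolution MvPolynomial
open Summit.ResolutionOfSingularities.ResolutionOfSingularities.Theorems.FInjectiveMacaulayfication

/-! ## The T₁₁/3 frame, Ψ-form of the chart presentations (C1-KERNEL clause, as res-type-034's R3 data half consumes it) -/

set_option maxHeartbeats 1600000 in
/-- **T₁₁/3 — `PFix₃` AT THE ORIGIN OF `X = V(T₁₁) ⊂ 𝔸⁴_k` (char 3) MODULO THE THREE DATA DELIVERIES** (`hstd`/`hoff`: level-1 model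
clauses; `hR3`: the curve data; `hblock64`/`hblock66`: level-2 blocks). See the module docstring. [folklore glue] -/
theorem t11_originPointFixable_char3_of_data' (k : Type) [Field k] [CharP k 3] (f : MvPolynomial (Fin 4) k)
    (hf : f = (X 2 ^ 2 + (X 1 ^ 2 + X 0 ^ 3) ^ 3 + X 0 ^ 11 + X 3 ^ 7 : MvPolynomial (Fin 4) k)) (hf0 : constantCoeff f = 0)
    -- LEVEL-1 MODEL CLAUSES (stub-5's producers on stub-4's cell texts)
    (hstd : ∀ c : Fin 87, T11Char3Poly.SSoff c = [] →
      ∀ (Q' : Ideal (MvPolynomial (Fin 4) k ⧸ Ideal.span {(KLocCellKit.evalL k (T11Char7Poly.G c))})) [Q'.IsMaximal],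
        (∀ j ∈ (Finset.univ : Finset (Fin 4)), Ideal.Quotient.mk (Ideal.span {(KLocCellKit.evalL k (T11Char7Poly.G c))})
          (aeval (fun j : Fin 4 => ∏ i : Fin 4, (X i : MvPolynomial (Fin 4) k) ^ T11Char7Fan.V c i j) (X j : MvPolynomial (Fin 4) k)) ∈ Q') →
        ∀ dd : ℕ, ringKrullDim (Localization.AtPrime Q') = dd → ∀ s : Fin dd → Localization.AtPrime Q',
          (Ideal.span (Set.range s)).radical.IsMaximal →
            RingTheory.Sequence.IsWeaklyRegular (Localization.AtPrime Q') (List.ofFn s) ∧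
            ∀ y : Localization.AtPrime Q', (∃ e : ℕ, y ^ 3 ^ e ∈ Ideal.span
              ((fun z : Localization.AtPrime Q' => z ^ 3 ^ e) ''
                (Ideal.span (Set.range s) : Set (Localization.AtPrime Q')))) → y ∈ Ideal.span (Set.range s))
    (hoff : ∀ c : Fin 87, T11Char3Poly.SSoff c ≠ [] →
      ∀ (Q' : Ideal (MvPolynomial (Fin 4) k ⧸ Ideal.span {(KLocCellKit.evalL k (T11Char7Poly.G c))})) [Q'.IsMaximal],
        (∀ j ∈ (Finset.univ : Finset (Fin 4)), Ideal.Quotient.mk (Ideal.span {(KLocCellKit.evalL k (T11Char7Poly.G c))})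
          (aeval (fun j : Fin 4 => ∏ i : Fin 4, (X i : MvPolynomial (Fin 4) k) ^ T11Char7Fan.V c i j) (X j : MvPolynomial (Fin 4) k)) ∈ Q') →
        ¬ ((Ideal.span {x | x ∈ (T11Char3Poly.HS c).map (KLocCellKit.evalL k)}).map (Ideal.Quotient.mk (Ideal.span {(KLocCellKit.evalL k (T11Char7Poly.G c))}))) ≤ Q' →
        ∀ dd : ℕ, ringKrullDim (Localization.AtPrime Q') = dd → ∀ s : Fin dd → Localization.AtPrime Q',
          (Ideal.span (Set.range s)).radical.IsMaximal →
            RingTheory.Sequence.IsWeaklyRegular (Localization.AtPrime Q') (List.ofFn s) ∧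
            ∀ y : Localization.AtPrime Q', (∃ e : ℕ, y ^ 3 ^ e ∈ Ideal.span
              ((fun z : Localization.AtPrime Q' => z ^ 3 ^ e) ''
                (Ideal.span (Set.range s) : Set (Localization.AtPrime Q')))) → y ∈ Ideal.span (Set.range s))
    -- THE CURVE DATA (res-type-034's R3 data half), for any pinned sections isomorphisms and any (C1)-spec'd chart presentations
    (hR3 : ∀ (e : ∀ c : Fin 87, Γ(affineBlowup (Ideal.span ((fun e : Fin 4 →₀ ℕ => Ideal.Quotient.mk (Ideal.span {f}) (monomial e (1 : k))) '' (T11Char7Fan.A : Set (Fin 4 →₀ ℕ)))), (Proj.basicOpen (reesGrading (Ideal.span ((fun e : Fin 4 →₀ ℕ => Ideal.Quotient.mk (Ideal.span {f}) (monomial e (1 : k))) '' (T11Char7Fan.A : Set (Fin 4 →₀ ℕ))))) (reesT (I := (Ideal.span ((fun e : Fin 4 →₀ ℕ => Ideal.Quotient.mk (Ideal.span {f}) (monomial e (1 : k))) '' (T11Char7Fan.A : Set (Fin 4 →₀ ℕ))))) (Ideal.Quotient.mk (Ideal.span {f}) (monomial (T11Char7Fan.m c) (1 : k))) (Ideal.subset_span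 ⟨T11Char7Fan.m c, T11Char7Fan.hmA c, rfl⟩ : (Ideal.Quotient.mk (Ideal.span {f}) (monomial (T11Char7Fan.m c) (1 : k))) ∈ (Ideal.span ((fun e : Fin 4 →₀ ℕ => Ideal.Quotient.mk (Ideal.span {f}) (monomial e (1 : k))) '' (T11Char7Fan.A : Set (Fin 4 →₀ ℕ)))))))) ≃+* ↥(blowupAlgebra (Ideal.span ((fun e : Fin 4 →₀ ℕ => Ideal.Quotient.mk (Ideal.span {f}) (monomial e (1 : k))) '' (T11Char7Fan.A : Set (Fin 4 →₀ ℕ)))) (Ideal.Quotient.mk (Ideal.span {f}) (monomial (T11Char7Fan.m c) (1 : k)))))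
      (he₀ : ∀ (c : Fin 87) (gg : HomogeneousLocalization.Away (reesGrading (Ideal.span ((fun e : Fin 4 →₀ ℕ => Ideal.Quotient.mk (Ideal.span {f}) (monomial e (1 : k))) '' (T11Char7Fan.A : Set (Fin 4 →₀ ℕ))))) (reesT (I := (Ideal.span ((fun e : Fin 4 →₀ ℕ => Ideal.Quotient.mk (Ideal.span {f}) (monomial e (1 : k))) '' (T11Char7Fan.A : Set (Fin 4 →₀ ℕ))))) (Ideal.Quotient.mk (Ideal.span {f}) (monomial (T11Char7Fan.m c) (1 : k))) (Ideal.subset_span ⟨T11Char7Fan.m c, T11Char7Fan.hmA c, rfl⟩ : (Ideal.Quotient.mk (Ideal.span {f}) (monomial (T11Char7Fan.m c) (1 : k))) ∈ (Ideal.span ((fun e : Fin 4 →₀ ℕ => Ideal.Quotient.mk (Ideal.span {f}) (monomial e (1 : k))) '' (T11Char7Fan.A : Set (Fin 4 →₀ ℕ))))))),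
        e c ((Proj.basicOpenIsoAway (reesGrading (Ideal.span ((fun e : Fin 4 →₀ ℕ => Ideal.Quotient.mk (Ideal.span {f}) (monomial e (1 : k))) '' (T11Char7Fan.A : Set (Fin 4 →₀ ℕ))))) (reesT (I := (Ideal.span ((fun e : Fin 4 →₀ ℕ => Ideal.Quotient.mk (Ideal.span {f}) (monomial e (1 : k))) '' (T11Char7Fan.A : Set (Fin 4 →₀ ℕ))))) (Ideal.Quotient.mk (Ideal.span {f}) (monomial (T11Char7Fan.m c) (1 : k))) (Ideal.subset_span ⟨T11Char7Fan.m c, T11Char7Fan.hmA c, rfl⟩ : (Ideal.Quotient.mk (Ideal.span {f}) (monomial (T11Char7Fan.m c) (1 : k))) ∈ (Ideal.span ((fun e : Fin 4 →₀ ℕ => Ideal.Quotient.mk (Ideal.span {f}) (monomial e (1 : k))) '' (T11Char7Fan.A : Set (Fin 4 →₀ ℕ)))))) (reesT_mem (Ideal.Quotient.mk (Ideal.span {f}) (monomial (T11Char7Fan.m c) (1 : k))) (Ideal.subset_span ⟨T11Char7Fan.m c, T11Char7Fan.hmA c, rfl⟩ : (Ideal.Quotient.mk (Ideal.span {f}) (monomial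 (T11Char7Fan.m c) (1 : k))) ∈ (Ideal.span ((fun e : Fin 4 →₀ ℕ => Ideal.Quotient.mk (Ideal.span {f}) (monomial e (1 : k))) '' (T11Char7Fan.A : Set (Fin 4 →₀ ℕ)))))) Nat.one_pos).hom gg) =
          reesChartEquiv (Ideal.Quotient.mk (Ideal.span {f}) (monomial (T11Char7Fan.m c) (1 : k))) (Ideal.subset_span ⟨T11Char7Fan.m c, T11Char7Fan.hmA c, rfl⟩ : (Ideal.Quotient.mk (Ideal.span {f}) (monomial (T11Char7Fan.m c) (1 : k))) ∈ (Ideal.span ((fun e : Fin 4 →₀ ℕ => Ideal.Quotient.mk (Ideal.span {f}) (monomial e (1 : k))) '' (T11Char7Fan.A : Set (Fin 4 →₀ ℕ))))) gg)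
      (θ : ∀ c : Fin 87, (MvPolynomial (Fin 4) k ⧸ Ideal.span {(KLocCellKit.evalL k (T11Char7Poly.G c))}) ≃+* ↥(blowupAlgebra (Ideal.span ((fun e : Fin 4 →₀ ℕ => Ideal.Quotient.mk (Ideal.span {f}) (monomial e (1 : k))) '' (T11Char7Fan.A : Set (Fin 4 →₀ ℕ)))) (Ideal.Quotient.mk (Ideal.span {f}) (monomial (T11Char7Fan.m c) (1 : k)))))
      (hθ : ∀ (c : Fin 87) (q : MvPolynomial (Fin 4) k), ((θ c (Ideal.Quotient.mk (Ideal.span {(KLocCellKit.evalL k (T11Char7Poly.G c))}) q)) :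
          Localization.Away (Ideal.Quotient.mk (Ideal.span {f}) (monomial (T11Char7Fan.m c) (1 : k)))) = aeval (fun i : Fin 4 => algebraMap (MvPolynomial (Fin 4) k ⧸ Ideal.span {f}) (Localization.Away (Ideal.Quotient.mk (Ideal.span {f}) (monomial (T11Char7Fan.m c) (1 : k))))
            (Ideal.Quotient.mk (Ideal.span {f}) (monomial (T11Char7Fan.a c i) (1 : k))) * IsLocalization.Away.invSelf (Ideal.Quotient.mk (Ideal.span {f}) (monomial (T11Char7Fan.m c) (1 : k)))) q),
      ∃ ξ : ↥(affineBlowup (Ideal.span ((fun e : Fin 4 →₀ ℕ => Ideal.Quotient.mk (Ideal.span {f}) (monomial e (1 : k))) '' (T11Char7Fan.A : Set (Fin 4 →₀ ℕ))))), (affineBlowup.π (Ideal.span ((fun e : Fin 4 →₀ ℕ => Ideal.Quotient.mk (Ideal.span {f}) (monomial e (1 : k))) '' (T11Char7Fan.A : Set (Fin 4 →₀ ℕ))))).base ξ = (⟨Ideal.span (Set.range fun i : Fin 4 => Ideal.Quotient.mk (Ideal.span {f}) (X i)), (origin_isMaximal f hf0).isPrime⟩ : ↥(Spec (.of (MvPolynomial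 (Fin 4) k ⧸ Ideal.span {f})))) ∧
        (∀ c : Fin 87, T11Char3Poly.SSoff c ≠ [] → ((Scheme.IdealSheafData.vanishingIdeal (⟨closure ({ξ} : Set ↥(affineBlowup (Ideal.span ((fun e : Fin 4 →₀ ℕ => Ideal.Quotient.mk (Ideal.span {f}) (monomial e (1 : k))) '' (T11Char7Fan.A : Set (Fin 4 →₀ ℕ)))))), isClosed_closure⟩ : Closeds ↥(affineBlowup (Ideal.span ((fun e : Fin 4 →₀ ℕ => Ideal.Quotient.mk (Ideal.span {f}) (monomial e (1 : k))) '' (T11Char7Fan.A : Set (Fin 4 →₀ ℕ))))))).ideal (⟨(Proj.basicOpen (reesGrading (Ideal.span ((fun e : Fin 4 →₀ ℕ => Ideal.Quotient.mk (Ideal.span {f}) (monomial e (1 : k))) '' (T11Char7Fan.A : Set (Fin 4 →₀ ℕ))))) (reesT (I := (Ideal.span ((fun e : Fin 4 →₀ ℕ => Ideal.Quotient.mk (Ideal.span {f}) (monomial e (1 : k))) '' (T11Char7Fan.A : Set (Fin 4 →₀ ℕ))))) (Ideal.Quotient.mk (Ideal.span {f}) (monomial (T11Char7Fan.m c) (1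 : k))) (Ideal.subset_span ⟨T11Char7Fan.m c, T11Char7Fan.hmA c, rfl⟩ : (Ideal.Quotient.mk (Ideal.span {f}) (monomial (T11Char7Fan.m c) (1 : k))) ∈ (Ideal.span ((fun e : Fin 4 →₀ ℕ => Ideal.Quotient.mk (Ideal.span {f}) (monomial e (1 : k))) '' (T11Char7Fan.A : Set (Fin 4 →₀ ℕ))))))), AffineBlowupChartFrame.isAffineOpen_basicOpen_reesT (Ideal.span ((fun e : Fin 4 →₀ ℕ => Ideal.Quotient.mk (Ideal.span {f}) (monomial e (1 : k))) '' (T11Char7Fan.A : Set (Fin 4 →₀ ℕ)))) (Ideal.Quotient.mk (Ideal.span {f}) (monomial (T11Char7Fan.m c) (1 : k))) (Ideal.subset_span ⟨T11Char7Fan.m c, T11Char7Fan.hmA c, rfl⟩ : (Ideal.Quotient.mk (Ideal.span {f}) (monomial (T11Char7Fan.m c) (1 : k))) ∈ (Ideal.span ((fun e : Fin 4 →₀ ℕ => Ideal.Quotient.mk (Ideal.span {f}) (monomial e (1 : k))) '' (T11Char7Fan.A : Set (Fin 4 →₀ ℕ)))))⟩ : (affineBlowup (Ideal.span ((fun e :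 Fin 4 →₀ ℕ => Ideal.Quotient.mk (Ideal.span {f}) (monomial e (1 : k))) '' (T11Char7Fan.A : Set (Fin 4 →₀ ℕ))))).affineOpens)).map (e c) ≤ (((Ideal.span {x | x ∈ (T11Char3Poly.HS c).map (KLocCellKit.evalL k)}).map (Ideal.Quotient.mk (Ideal.span {(KLocCellKit.evalL k (T11Char7Poly.G c))})))).map (θ c)) ∧
        ((Scheme.IdealSheafData.vanishingIdeal (⟨closure ({ξ} : Set ↥(affineBlowup (Ideal.span ((fun e : Fin 4 →₀ ℕ => Ideal.Quotient.mk (Ideal.span {f}) (monomial e (1 : k))) '' (T11Char7Fan.A : Set (Fin 4 →₀ ℕ)))))), isClosed_closure⟩ : Closeds ↥(affineBlowup (Ideal.span ((fun e : Fin 4 →₀ ℕ => Ideal.Quotient.mk (Ideal.span {f}) (monomial e (1 : k))) '' (T11Char7Fan.A : Set (Fin 4 →₀ ℕ))))))).ideal (⟨(Proj.basicOpen (reesGrading (Ideal.span ((fun e : Fin 4 →₀ ℕ => Ideal.Quotient.mk (Ideal.span {f}) (monomial e (1 : k))) '' (T11Char7Fan.A : Set (Fin 4 →₀ ℕ)))))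 (reesT (I := (Ideal.span ((fun e : Fin 4 →₀ ℕ => Ideal.Quotient.mk (Ideal.span {f}) (monomial e (1 : k))) '' (T11Char7Fan.A : Set (Fin 4 →₀ ℕ))))) (Ideal.Quotient.mk (Ideal.span {f}) (monomial (T11Char7Fan.m 64) (1 : k))) (Ideal.subset_span ⟨T11Char7Fan.m 64, T11Char7Fan.hmA 64, rfl⟩ : (Ideal.Quotient.mk (Ideal.span {f}) (monomial (T11Char7Fan.m 64) (1 : k))) ∈ (Ideal.span ((fun e : Fin 4 →₀ ℕ => Ideal.Quotient.mk (Ideal.span {f}) (monomial e (1 : k))) '' (T11Char7Fan.A : Set (Fin 4 →₀ ℕ))))))), AffineBlowupChartFrame.isAffineOpen_basicOpen_reesT (Ideal.span ((fun e : Fin 4 →₀ ℕ => Ideal.Quotient.mk (Ideal.span {f}) (monomial e (1 : k))) '' (T11Char7Fan.A : Set (Fin 4 →₀ ℕ)))) (Ideal.Quotient.mk (Ideal.span {f}) (monomial (T11Char7Fan.m 64) (1 : k))) (Ideal.subset_span ⟨T11Char7Fan.m 64, T11Char7Fan.hmA 64, rfl⟩ : (Ideal.Quotient.mk (Ideal.span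 {f}) (monomial (T11Char7Fan.m 64) (1 : k))) ∈ (Ideal.span ((fun e : Fin 4 →₀ ℕ => Ideal.Quotient.mk (Ideal.span {f}) (monomial e (1 : k))) '' (T11Char7Fan.A : Set (Fin 4 →₀ ℕ)))))⟩ : (affineBlowup (Ideal.span ((fun e : Fin 4 →₀ ℕ => Ideal.Quotient.mk (Ideal.span {f}) (monomial e (1 : k))) '' (T11Char7Fan.A : Set (Fin 4 →₀ ℕ))))).affineOpens)).map (e 64) = (((Ideal.span {x | x ∈ (T11Char3Poly.HS 64).map (KLocCellKit.evalL k)}).map (Ideal.Quotient.mk (Ideal.span {(KLocCellKit.evalL k (T11Char7Poly.G 64))})))).map (θ 64) ∧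
        ((Scheme.IdealSheafData.vanishingIdeal (⟨closure ({ξ} : Set ↥(affineBlowup (Ideal.span ((fun e : Fin 4 →₀ ℕ => Ideal.Quotient.mk (Ideal.span {f}) (monomial e (1 : k))) '' (T11Char7Fan.A : Set (Fin 4 →₀ ℕ)))))), isClosed_closure⟩ : Closeds ↥(affineBlowup (Ideal.span ((fun e : Fin 4 →₀ ℕ => Ideal.Quotient.mk (Ideal.span {f}) (monomial e (1 : k))) '' (T11Char7Fan.A : Set (Fin 4 →₀ ℕ))))))).ideal (⟨(Proj.basicOpen (reesGrading (Ideal.span ((fun e : Fin 4 →₀ ℕ => Ideal.Quotient.mk (Ideal.span {f}) (monomial e (1 : k))) '' (T11Char7Fan.A : Set (Fin 4 →₀ ℕ))))) (reesT (I := (Ideal.span ((fun e : Fin 4 →₀ ℕ => Ideal.Quotient.mk (Ideal.span {f}) (monomial e (1 : k))) '' (T11Char7Fan.A : Set (Fin 4 →₀ ℕ))))) (Ideal.Quotient.mk (Ideal.span {f}) (monomial (T11Char7Fan.m 66) (1 : k))) (Ideal.subset_span ⟨T11Char7Fan.m 66, T11Char7Fan.hmA 66, rfl⟩ : (Ideal.Quotient.mk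 (Ideal.span {f}) (monomial (T11Char7Fan.m 66) (1 : k))) ∈ (Ideal.span ((fun e : Fin 4 →₀ ℕ => Ideal.Quotient.mk (Ideal.span {f}) (monomial e (1 : k))) '' (T11Char7Fan.A : Set (Fin 4 →₀ ℕ))))))), AffineBlowupChartFrame.isAffineOpen_basicOpen_reesT (Ideal.span ((fun e : Fin 4 →₀ ℕ => Ideal.Quotient.mk (Ideal.span {f}) (monomial e (1 : k))) '' (T11Char7Fan.A : Set (Fin 4 →₀ ℕ)))) (Ideal.Quotient.mk (Ideal.span {f}) (monomial (T11Char7Fan.m 66) (1 : k))) (Ideal.subset_span ⟨T11Char7Fan.m 66, T11Char7Fan.hmA 66, rfl⟩ : (Ideal.Quotient.mk (Ideal.span {f}) (monomial (T11Char7Fan.m 66) (1 : k))) ∈ (Ideal.span ((fun e : Fin 4 →₀ ℕ => Ideal.Quotient.mk (Ideal.span {f}) (monomial e (1 : k))) '' (T11Char7Fan.A : Set (Fin 4 →₀ ℕ)))))⟩ : (affineBlowup (Ideal.span ((fun e : Fin 4 →₀ ℕ => Ideal.Quotient.mk (Ideal.span {f}) (monomial e (1 : k))) '' (T11Char7Fan.A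 : Set (Fin 4 →₀ ℕ))))).affineOpens)).map (e 66) = (((Ideal.span {x | x ∈ (T11Char3Poly.HS 66).map (KLocCellKit.evalL k)}).map (Ideal.Quotient.mk (Ideal.span {(KLocCellKit.evalL k (T11Char7Poly.G 66))})))).map (θ 66) ∧
        (∀ x' : ↥(affineBlowup (Ideal.span ((fun e : Fin 4 →₀ ℕ => Ideal.Quotient.mk (Ideal.span {f}) (monomial e (1 : k))) '' (T11Char7Fan.A : Set (Fin 4 →₀ ℕ))))), x' ∈ closure ({ξ} : Set ↥(affineBlowup (Ideal.span ((fun e : Fin 4 →₀ ℕ => Ideal.Quotient.mk (Ideal.span {f}) (monomial e (1 : k))) '' (T11Char7Fan.A : Set (Fin 4 →₀ ℕ)))))) → ∃ c ∈ ({64, 66} : Set (Fin 87)), x' ∈ (Proj.basicOpen (reesGrading (Ideal.span ((fun e : Fin 4 →₀ ℕ => Ideal.Quotient.mk (Ideal.span {f}) (monomial e (1 : k))) '' (T11Char7Fan.A : Set (Fin 4 →₀ ℕ))))) (reesT (I := (Ideal.span ((fun e : Fin 4 →₀ ℕ => Ideal.Quotient.mk (Ideal.span {f}) (monomial e (1 :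 k))) '' (T11Char7Fan.A : Set (Fin 4 →₀ ℕ))))) (Ideal.Quotient.mk (Ideal.span {f}) (monomial (T11Char7Fan.m c) (1 : k))) (Ideal.subset_span ⟨T11Char7Fan.m c, T11Char7Fan.hmA c, rfl⟩ : (Ideal.Quotient.mk (Ideal.span {f}) (monomial (T11Char7Fan.m c) (1 : k))) ∈ (Ideal.span ((fun e : Fin 4 →₀ ℕ => Ideal.Quotient.mk (Ideal.span {f}) (monomial e (1 : k))) '' (T11Char7Fan.A : Set (Fin 4 →₀ ℕ)))))))))
    -- LEVEL-2 BLOCKS on the models of the hon charts 64 and 66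
    (hblock64 : ∃ (t₂ : ℕ) (w₂ : Fin t₂ → (MvPolynomial (Fin 4) k ⧸ Ideal.span {(KLocCellKit.evalL k (T11Char7Poly.G 64))})) (hw₂ : ∀ j : Fin t₂, w₂ j ∈ ((Ideal.span {x | x ∈ (T11Char3Poly.HS 64).map (KLocCellKit.evalL k)}).map (Ideal.Quotient.mk (Ideal.span {(KLocCellKit.evalL k (T11Char7Poly.G 64))})))),
        (HomogeneousIdeal.irrelevant (reesGrading ((Ideal.span {x | x ∈ (T11Char3Poly.HS 64).map (KLocCellKit.evalL k)}).map (Ideal.Quotient.mk (Ideal.span {(KLocCellKit.evalL k (T11Char7Poly.G 64))}))))).toIdeal ≤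
          (Ideal.span (Set.range fun j : Fin t₂ => reesT (I := ((Ideal.span {x | x ∈ (T11Char3Poly.HS 64).map (KLocCellKit.evalL k)}).map (Ideal.Quotient.mk (Ideal.span {(KLocCellKit.evalL k (T11Char7Poly.G 64))})))) (w₂ j) (hw₂ j))).radical ∧
        (∀ j : Fin t₂, w₂ j ≠ 0) ∧
        ∀ (j : Fin t₂) (Q : Ideal (blowupAlgebra ((Ideal.span {x | x ∈ (T11Char3Poly.HS 64).map (KLocCellKit.evalL k)}).map (Ideal.Quotient.mk (Ideal.span {(KLocCellKit.evalL k (T11Char7Poly.G 64))}))) (w₂ j))) [Q.IsMaximal],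
          algebraMap (MvPolynomial (Fin 4) k ⧸ Ideal.span {(KLocCellKit.evalL k (T11Char7Poly.G 64))}) (blowupAlgebra ((Ideal.span {x | x ∈ (T11Char3Poly.HS 64).map (KLocCellKit.evalL k)}).map (Ideal.Quotient.mk (Ideal.span {(KLocCellKit.evalL k (T11Char7Poly.G 64))}))) (w₂ j)) (w₂ j) ∈ Q →
          ∀ dd : ℕ, ringKrullDim (Localization.AtPrime Q) = dd → ∀ s : Fin dd → Localization.AtPrime Q,
          (Ideal.span (Set.range s)).radical.IsMaximal →
            RingTheory.Sequence.IsWeaklyRegular (Localization.AtPrime Q) (List.ofFn s) ∧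
            ∀ y : Localization.AtPrime Q, (∃ e : ℕ, y ^ 3 ^ e ∈ Ideal.span
              ((fun z : Localization.AtPrime Q => z ^ 3 ^ e) ''
                (Ideal.span (Set.range s) : Set (Localization.AtPrime Q)))) → y ∈ Ideal.span (Set.range s))
    (hblock66 : ∃ (t₂ : ℕ) (w₂ : Fin t₂ → (MvPolynomial (Fin 4) k ⧸ Ideal.span {(KLocCellKit.evalL k (T11Char7Poly.G 66))})) (hw₂ : ∀ j : Fin t₂, w₂ j ∈ ((Ideal.span {x | x ∈ (T11Char3Poly.HS 66).map (KLocCellKit.evalL k)}).map (Ideal.Quotient.mk (Ideal.span {(KLocCellKit.evalL k (T11Char7Poly.G 66))})))),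
        (HomogeneousIdeal.irrelevant (reesGrading ((Ideal.span {x | x ∈ (T11Char3Poly.HS 66).map (KLocCellKit.evalL k)}).map (Ideal.Quotient.mk (Ideal.span {(KLocCellKit.evalL k (T11Char7Poly.G 66))}))))).toIdeal ≤
          (Ideal.span (Set.range fun j : Fin t₂ => reesT (I := ((Ideal.span {x | x ∈ (T11Char3Poly.HS 66).map (KLocCellKit.evalL k)}).map (Ideal.Quotient.mk (Ideal.span {(KLocCellKit.evalL k (T11Char7Poly.G 66))})))) (w₂ j) (hw₂ j))).radical ∧
        (∀ j : Fin t₂, w₂ j ≠ 0) ∧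
        ∀ (j : Fin t₂) (Q : Ideal (blowupAlgebra ((Ideal.span {x | x ∈ (T11Char3Poly.HS 66).map (KLocCellKit.evalL k)}).map (Ideal.Quotient.mk (Ideal.span {(KLocCellKit.evalL k (T11Char7Poly.G 66))}))) (w₂ j))) [Q.IsMaximal],
          algebraMap (MvPolynomial (Fin 4) k ⧸ Ideal.span {(KLocCellKit.evalL k (T11Char7Poly.G 66))}) (blowupAlgebra ((Ideal.span {x | x ∈ (T11Char3Poly.HS 66).map (KLocCellKit.evalL k)}).map (Ideal.Quotient.mk (Ideal.span {(KLocCellKit.evalL k (T11Char7Poly.G 66))}))) (w₂ j)) (w₂ j) ∈ Q →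
          ∀ dd : ℕ, ringKrullDim (Localization.AtPrime Q) = dd → ∀ s : Fin dd → Localization.AtPrime Q,
          (Ideal.span (Set.range s)).radical.IsMaximal →
            RingTheory.Sequence.IsWeaklyRegular (Localization.AtPrime Q) (List.ofFn s) ∧
            ∀ y : Localization.AtPrime Q, (∃ e : ℕ, y ^ 3 ^ e ∈ Ideal.span
              ((fun z : Localization.AtPrime Q => z ^ 3 ^ e) ''
                (Ideal.span (Set.range s) : Set (Localization.AtPrime Q)))) → y ∈ Ideal.span (Set.range s)) :
    ∃ (nc : ℕ) (c : Fin nc → (Spec (.of (MvPolynomial (Fin 4) k ⧸ Ideal.span {f}))).presheaf.stalk (⟨Ideal.span (Set.range fun i : Fin 4 => Ideal.Quotient.mk (Ideal.span {f}) (X i)), (origin_isMaximal f hf0).isPrime⟩ : ↥(Spec (.of (MvPolynomial (Fin 4) k ⧸ Ideal.span {f}))))), Ideal.span (Set.range c) ≠ ⊥ ∧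
      (Ideal.span (Set.range c)).radical = IsLocalRing.maximalIdeal ((Spec (.of (MvPolynomial (Fin 4) k ⧸ Ideal.span {f}))).presheaf.stalk (⟨Ideal.span (Set.range fun i : Fin 4 => Ideal.Quotient.mk (Ideal.span {f}) (X i)), (origin_isMaximal f hf0).isPrime⟩ : ↥(Spec (.of (MvPolynomial (Fin 4) k ⧸ Ideal.span {f}))))) ∧
      ∀ (j : Fin nc) (𝔔 : PrimeSpectrum (blowupAlgebra (Ideal.span (Set.range c)) (c j))),
        𝔔.asIdeal.comap (algebraMap ((Spec (.of (MvPolynomial (Fin 4) k ⧸ Ideal.span {f}))).presheaf.stalk (⟨Ideal.span (Set.range fun i : Fin 4 => Ideal.Quotient.mk (Ideal.span {f}) (X i)), (origin_isMaximal f hf0).isPrime⟩ : ↥(Spec (.of (MvPolynomial (Fin 4) k ⧸ Ideal.span {f}))))) (blowupAlgebra (Ideal.span (Set.range c)) (c j))) =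
          IsLocalRing.maximalIdeal ((Spec (.of (MvPolynomial (Fin 4) k ⧸ Ideal.span {f}))).presheaf.stalk (⟨Ideal.span (Set.range fun i : Fin 4 => Ideal.Quotient.mk (Ideal.span {f}) (X i)), (origin_isMaximal f hf0).isPrime⟩ : ↥(Spec (.of (MvPolynomial (Fin 4) k ⧸ Ideal.span {f}))))) →
        IsDomain (Localization.AtPrime 𝔔.asIdeal) ∧ ∀ dd : ℕ, ringKrullDim (Localization.AtPrime 𝔔.asIdeal) = dd → ∀ s : Fin dd → Localization.AtPrime 𝔔.asIdeal,
          (Ideal.span (Set.range s)).radical.IsMaximal →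
            RingTheory.Sequence.IsWeaklyRegular (Localization.AtPrime 𝔔.asIdeal) (List.ofFn s) ∧
            ∀ y : Localization.AtPrime 𝔔.asIdeal, (∃ e : ℕ, y ^ 3 ^ e ∈ Ideal.span
              ((fun z : Localization.AtPrime 𝔔.asIdeal => z ^ 3 ^ e) ''
                (Ideal.span (Set.range s) : Set (Localization.AtPrime 𝔔.asIdeal)))) → y ∈ Ideal.span (Set.range s) := by
  classical
  haveI : Fact (Nat.Prime 3) := ⟨Nat.prime_three⟩
  have hprime : (Ideal.span {f}).IsPrime := T11HypersurfacePrime.isPrime_span_T11 k f hf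
  have hXne : ∀ v : Fin 4, Ideal.Quotient.mk (Ideal.span {f}) (X v) ≠ 0 := T11HypersurfacePrime.mk_X_ne_zero_T11 k f hf
  haveI := hprime
  haveI : IsDomain (MvPolynomial (Fin 4) k ⧸ Ideal.span {f}) := Ideal.Quotient.isDomain _
  haveI : CharP (MvPolynomial (Fin 4) k ⧸ Ideal.span {f}) 3 := charP_of_injective_algebraMap (algebraMap k (MvPolynomial (Fin 4) k ⧸ Ideal.span {f})).injective 3
  -- the origin, the centre
  have hbmax := origin_isMaximal f hf0
  have hIb := radical_monomialCentre_eq_origin f hf0 T11Char7Fan.A T11Char7Fan.hprim T11Char7Fan.hAJ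
  have hI0 := monomialCentre_ne_bot f (by norm_num) hXne T11Char7Fan.A T11Char7Fan.hAJ
  have hw0 : ∀ c : Fin 87, Ideal.Quotient.mk (Ideal.span {f}) (monomial (T11Char7Fan.m c) (1 : k)) ≠ 0 := fun c =>
    CIConeFiModelCore.mk_monomial_ne_zero (Ideal.span {f}) hXne (T11Char7Fan.m c)
  have hcover := reesCover_of_fanCover f T11Char7Fan.A T11Char7Fan.m T11Char7Fan.hmA (T11Char7Fan.hcov k)
  -- the pinned sections isomorphisms of the 87 Rees charts
  have hex := fun c : Fin 87 => AffineBlowupChartTransport.exists_sectionsEquiv_eq (Ideal.span ((fun e : Fin 4 →₀ ℕ => Ideal.Quotient.mk (Ideal.span {f}) (monomial e (1 : k))) '' (T11Char7Fan.A : Set (Fin 4 →₀ ℕ))))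
    (Ideal.Quotient.mk (Ideal.span {f}) (monomial (T11Char7Fan.m c) (1 : k)))
    (Ideal.subset_span ⟨T11Char7Fan.m c, T11Char7Fan.hmA c, rfl⟩ : Ideal.Quotient.mk (Ideal.span {f}) (monomial (T11Char7Fan.m c) (1 : k)) ∈ (Ideal.span ((fun e : Fin 4 →₀ ℕ => Ideal.Quotient.mk (Ideal.span {f}) (monomial e (1 : k))) '' (T11Char7Fan.A : Set (Fin 4 →₀ ℕ)))))
  choose e he₀ using hex
  have he : ∀ (c : Fin 87) (r : (MvPolynomial (Fin 4) k ⧸ Ideal.span {f})), e c ((affineBlowup.π (Ideal.span ((fun e : Fin 4 →₀ ℕ => Ideal.Quotient.mk (Ideal.span {f}) (monomial e (1 : k))) '' (T11Char7Fan.A : Set (Fin 4 →₀ ℕ))))).appLE ⊤ _ le_top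
      ((Scheme.ΓSpecIso (CommRingCat.of (MvPolynomial (Fin 4) k ⧸ Ideal.span {f}))).inv r)) = algebraMap (MvPolynomial (Fin 4) k ⧸ Ideal.span {f}) _ r := fun c r =>
    AffineBlowupChartTransport.compat_of_sectionsEquiv_eq (e c) (he₀ c) r
  -- the (C1) chart presentations, KERNEL form (Ψ-clause for all `q` and θ-clause)
  have hexθ := fun c : Fin 87 => MonomialChartPresentationKernel.exists_monomialChartPresentation f (T11Char7Fan.V c)
    (T11Char7Fan.hV c) (T11Char7Fan.m c) (T11Char7Fan.a c) (T11Char7Fan.hgen c) T11Char7Fan.A (T11Char7Fan.haA c) (T11Char7Fan.hge c)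
    (T11Char7Fan.d c 0) (KLocCellKit.evalL k (T11Char7Poly.G c)) (by subst hf; exact T11Char7Poly.hθF₀ k c) (T11Char7Fan.hunit c 0)
    (T11Char3Poly.hX3 k c)
  choose θ₀ hbij hΨ₀ hθ₀ using hexθ
  have hΨ : ∀ (c : Fin 87) (q : MvPolynomial (Fin 4) k), ((RingEquiv.ofBijective (θ₀ c) (hbij c)
      (Ideal.Quotient.mk (Ideal.span {KLocCellKit.evalL k (T11Char7Poly.G c)}) q)) :
        Localization.Away (Ideal.Quotient.mk (Ideal.span {f}) (monomial (T11Char7Fan.m c) (1 : k)))) =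
      aeval (fun i : Fin 4 => algebraMap (MvPolynomial (Fin 4) k ⧸ Ideal.span {f})
        (Localization.Away (Ideal.Quotient.mk (Ideal.span {f}) (monomial (T11Char7Fan.m c) (1 : k))))
        (Ideal.Quotient.mk (Ideal.span {f}) (monomial (T11Char7Fan.a c i) (1 : k))) *
        IsLocalization.Away.invSelf (Ideal.Quotient.mk (Ideal.span {f}) (monomial (T11Char7Fan.m c) (1 : k)))) q :=
    fun c q => hΨ₀ c q
  have hθ : ∀ (c : Fin 87) (j : Fin 4), ((RingEquiv.ofBijective (θ₀ c) (hbij c)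
      (Ideal.Quotient.mk (Ideal.span {KLocCellKit.evalL k (T11Char7Poly.G c)}) (∏ i : Fin 4, (X i : MvPolynomial (Fin 4) k) ^ T11Char7Fan.V c i j))) :
        Localization.Away (Ideal.Quotient.mk (Ideal.span {f}) (monomial (T11Char7Fan.m c) (1 : k)))) =
      algebraMap (MvPolynomial (Fin 4) k ⧸ Ideal.span {f}) (Localization.Away (Ideal.Quotient.mk (Ideal.span {f}) (monomial (T11Char7Fan.m c) (1 : k)))) (Ideal.Quotient.mk (Ideal.span {f}) (X j)) := by
    intro c j
    have h := hθ₀ c (X j)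
    rw [aeval_X] at h
    exact h
  have H := hR3 e he₀ (fun c => RingEquiv.ofBijective (θ₀ c) (hbij c)) hΨ
  obtain ⟨ξ, hrest⟩ := H
  have hξ := hrest.1
  have hR3a := hrest.2.1
  have hR3b64 := hrest.2.2.1
  have hR3b66 := hrest.2.2.2.1
  have hSc := hrest.2.2.2.2
  -- (R3a): the true curve ideal lies in the model ideal (`⊤` off the avoid charts)
  have hP'' : ∀ c : Fin 87, ((Scheme.IdealSheafData.vanishingIdeal (⟨closure ({ξ} : Set ↥(affineBlowup (Ideal.span ((fun e : Fin 4 →₀ ℕ => Ideal.Quotient.mk (Ideal.span {f}) (monomial e (1 : k))) '' (T11Char7Fan.A : Set (Fin 4 →₀ ℕ)))))), isClosed_closure⟩ : Closeds ↥(affineBlowup (Ideal.span ((fun e : Fin 4 →₀ ℕ => Ideal.Quotient.mk (Ideal.span {f}) (monomial e (1 : k))) '' (T11Char7Fan.A : Set (Fin 4 →₀ ℕ))))))).ideal (⟨(Proj.basicOpen (reesGrading (Ideal.span ((fun e : Fin 4 →₀ ℕ => Ideal.Quotient.mk (Ideal.span {f}) (monomial e (1 : k))) '' (T11Char7Fan.A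 : Set (Fin 4 →₀ ℕ))))) (reesT (I := (Ideal.span ((fun e : Fin 4 →₀ ℕ => Ideal.Quotient.mk (Ideal.span {f}) (monomial e (1 : k))) '' (T11Char7Fan.A : Set (Fin 4 →₀ ℕ))))) (Ideal.Quotient.mk (Ideal.span {f}) (monomial (T11Char7Fan.m c) (1 : k))) (Ideal.subset_span ⟨T11Char7Fan.m c, T11Char7Fan.hmA c, rfl⟩ : (Ideal.Quotient.mk (Ideal.span {f}) (monomial (T11Char7Fan.m c) (1 : k))) ∈ (Ideal.span ((fun e : Fin 4 →₀ ℕ => Ideal.Quotient.mk (Ideal.span {f}) (monomial e (1 : k))) '' (T11Char7Fan.A : Set (Fin 4 →₀ ℕ))))))), AffineBlowupChartFrame.isAffineOpen_basicOpen_reesT (Ideal.span ((fun e : Fin 4 →₀ ℕ => Ideal.Quotient.mk (Ideal.span {f}) (monomial e (1 : k))) '' (T11Char7Fan.A : Set (Fin 4 →₀ ℕ)))) (Ideal.Quotient.mk (Ideal.span {f}) (monomial (T11Char7Fan.m c) (1 : k))) (Ideal.subset_span ⟨T11Char7Fan.m c, T11Char7Fan.hmA c, rfl⟩ : (Ideal.Quotient.mk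 (Ideal.span {f}) (monomial (T11Char7Fan.m c) (1 : k))) ∈ (Ideal.span ((fun e : Fin 4 →₀ ℕ => Ideal.Quotient.mk (Ideal.span {f}) (monomial e (1 : k))) '' (T11Char7Fan.A : Set (Fin 4 →₀ ℕ)))))⟩ : (affineBlowup (Ideal.span ((fun e : Fin 4 →₀ ℕ => Ideal.Quotient.mk (Ideal.span {f}) (monomial e (1 : k))) '' (T11Char7Fan.A : Set (Fin 4 →₀ ℕ))))).affineOpens)).map (e c) ≤
      ((if T11Char3Poly.SSoff c = [] then ⊤ else ((Ideal.span {x | x ∈ (T11Char3Poly.HS c).map (KLocCellKit.evalL k)}).map (Ideal.Quotient.mk (Ideal.span {(KLocCellKit.evalL k (T11Char7Poly.G c))}))))).map (RingEquiv.ofBijective (θ₀ c) (hbij c)) := by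
    intro c
    by_cases h : T11Char3Poly.SSoff c = []
    · simp only [h, ↓reduceIte, Ideal.map_top]
      exact le_top
    · simp only [h, ↓reduceIte]
      exact hR3a c h
  -- the model fibre ideals `(θ_c(x_j))_j` are `𝔪₀ · R[I/w_c]`
  have h𝔟'' : ∀ c : Fin 87, ((Ideal.span (Set.range fun j : Fin 4 => Ideal.Quotient.mk (Ideal.span {(KLocCellKit.evalL k (T11Char7Poly.G c))}) (aeval (fun j : Fin 4 => ∏ i : Fin 4, (X i : MvPolynomial (Fin 4) k) ^ T11Char7Fan.V c i j) (X j : MvPolynomial (Fin 4) k))))).map (RingEquiv.ofBijective (θ₀ c) (hbij c)) =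
      (Ideal.span (Set.range fun i : Fin 4 => Ideal.Quotient.mk (Ideal.span {f}) (X i))).map (algebraMap (MvPolynomial (Fin 4) k ⧸ Ideal.span {f}) (blowupAlgebra (Ideal.span ((fun e : Fin 4 →₀ ℕ => Ideal.Quotient.mk (Ideal.span {f}) (monomial e (1 : k))) '' (T11Char7Fan.A : Set (Fin 4 →₀ ℕ)))) (Ideal.Quotient.mk (Ideal.span {f}) (monomial (T11Char7Fan.m c) (1 : k))))) := by
    intro c
    rw [Ideal.map_span, Ideal.map_span, ← Set.range_comp, ← Set.range_comp]
    refine congrArg Ideal.span (congrArg Set.range (funext fun j => ?_))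
    apply Subtype.ext
    simp only [Function.comp_apply, aeval_X]
    rw [hθ c j]
    rfl
  -- LEVEL-1 model clauses from the producers
  have hmodel : ∀ (c : Fin 87) (Q' : Ideal (MvPolynomial (Fin 4) k ⧸ Ideal.span {(KLocCellKit.evalL k (T11Char7Poly.G c))})) [Q'.IsMaximal], ¬ (if T11Char3Poly.SSoff c = [] then ⊤ else ((Ideal.span {x | x ∈ (T11Char3Poly.HS c).map (KLocCellKit.evalL k)}).map (Ideal.Quotient.mk (Ideal.span {(KLocCellKit.evalL k (T11Char7Poly.G c))})))) ≤ Q' → (Ideal.span (Set.range fun j : Fin 4 => Ideal.Quotient.mk (Ideal.span {(KLocCellKit.evalL k (T11Char7Poly.G c))}) (aeval (fun j : Fin 4 => ∏ i : Fin 4, (X i : MvPolynomial (Fin 4) k) ^ T11Char7Fan.V c i j) (X j : MvPolynomial (Fin 4) k)))) ≤ Q' →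
      ∀ dd : ℕ, ringKrullDim (Localization.AtPrime Q') = dd → ∀ s : Fin dd → Localization.AtPrime Q',
          (Ideal.span (Set.range s)).radical.IsMaximal →
            RingTheory.Sequence.IsWeaklyRegular (Localization.AtPrime Q') (List.ofFn s) ∧
            ∀ y : Localization.AtPrime Q', (∃ e : ℕ, y ^ 3 ^ e ∈ Ideal.span
              ((fun z : Localization.AtPrime Q' => z ^ 3 ^ e) ''
                (Ideal.span (Set.range s) : Set (Localization.AtPrime Q')))) → y ∈ Ideal.span (Set.range s) := by
    intro c Q' _ hPQ hbQ
    have hj : ∀ j ∈ (Finset.univ : Finset (Fin 4)), Ideal.Quotient.mk (Ideal.span {(KLocCellKit.evalL k (T11Char7Poly.G c))})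
        (aeval (fun j : Fin 4 => ∏ i : Fin 4, (X i : MvPolynomial (Fin 4) k) ^ T11Char7Fan.V c i j) (X j : MvPolynomial (Fin 4) k)) ∈ Q' :=
      fun j _ => hbQ (Ideal.subset_span ⟨j, rfl⟩)
    by_cases h : T11Char3Poly.SSoff c = []
    · exact hstd c h Q' hj
    · have hPQ' : ¬ ((Ideal.span {x | x ∈ (T11Char3Poly.HS c).map (KLocCellKit.evalL k)}).map (Ideal.Quotient.mk (Ideal.span {(KLocCellKit.evalL k (T11Char7Poly.G c))}))) ≤ Q' := by
        simpa only [h, ↓reduceIte] using hPQ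
      exact hoff c h Q' hj hPQ'
  -- (R3b) and the LEVEL-2 blocks on the two hon charts
  have hI₂ : ∀ σ : ↥(({64, 66} : Set (Fin 87))), ((Scheme.IdealSheafData.vanishingIdeal (⟨closure ({ξ} : Set ↥(affineBlowup (Ideal.span ((fun e : Fin 4 →₀ ℕ => Ideal.Quotient.mk (Ideal.span {f}) (monomial e (1 : k))) '' (T11Char7Fan.A : Set (Fin 4 →₀ ℕ)))))), isClosed_closure⟩ : Closeds ↥(affineBlowup (Ideal.span ((fun e : Fin 4 →₀ ℕ => Ideal.Quotient.mk (Ideal.span {f}) (monomial e (1 : k))) '' (T11Char7Fan.A : Set (Fin 4 →₀ ℕ))))))).ideal (⟨(Proj.basicOpen (reesGrading (Ideal.span ((fun e : Fin 4 →₀ ℕ => Ideal.Quotient.mk (Ideal.span {f}) (monomial e (1 : k))) '' (T11Char7Fan.A : Set (Fin 4 →₀ ℕ))))) (reesT (I := (Ideal.span ((fun e : Fin 4 →₀ ℕ => Ideal.Quotient.mk (Ideal.span {f}) (monomial e (1 : k))) '' (T11Char7Fan.A : Set (Fin 4 →₀ ℕ))))) (Ideal.Quotient.mk (Ideal.span {f})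 (monomial (T11Char7Fan.m σ) (1 : k))) (Ideal.subset_span ⟨T11Char7Fan.m σ, T11Char7Fan.hmA σ, rfl⟩ : (Ideal.Quotient.mk (Ideal.span {f}) (monomial (T11Char7Fan.m σ) (1 : k))) ∈ (Ideal.span ((fun e : Fin 4 →₀ ℕ => Ideal.Quotient.mk (Ideal.span {f}) (monomial e (1 : k))) '' (T11Char7Fan.A : Set (Fin 4 →₀ ℕ))))))), AffineBlowupChartFrame.isAffineOpen_basicOpen_reesT (Ideal.span ((fun e : Fin 4 →₀ ℕ => Ideal.Quotient.mk (Ideal.span {f}) (monomial e (1 : k))) '' (T11Char7Fan.A : Set (Fin 4 →₀ ℕ)))) (Ideal.Quotient.mk (Ideal.span {f}) (monomial (T11Char7Fan.m σ) (1 : k))) (Ideal.subset_span ⟨T11Char7Fan.m σ, T11Char7Fan.hmA σ, rfl⟩ : (Ideal.Quotient.mk (Ideal.span {f}) (monomial (T11Char7Fan.m σ) (1 : k))) ∈ (Ideal.span ((fun e : Fin 4 →₀ ℕ => Ideal.Quotient.mk (Ideal.span {f}) (monomial e (1 : k))) '' (T11Char7Fan.A : Set (Fin 4 →₀ ℕ)))))⟩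 : (affineBlowup (Ideal.span ((fun e : Fin 4 →₀ ℕ => Ideal.Quotient.mk (Ideal.span {f}) (monomial e (1 : k))) '' (T11Char7Fan.A : Set (Fin 4 →₀ ℕ))))).affineOpens)).map (e σ) =
      (((Ideal.span {x | x ∈ (T11Char3Poly.HS σ).map (KLocCellKit.evalL k)}).map (Ideal.Quotient.mk (Ideal.span {(KLocCellKit.evalL k (T11Char7Poly.G σ))})))).map (RingEquiv.ofBijective (θ₀ σ) (hbij σ)) := by
    rintro ⟨c, hc⟩
    rcases (Set.mem_insert_iff.mp hc) with rfl | hc'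
    · exact hR3b64
    · rw [Set.mem_singleton_iff] at hc'
      subst hc'
      exact hR3b66
  have hblock : ∀ σ : ↥(({64, 66} : Set (Fin 87))),
      ∃ (t₂ : ℕ) (w₂ : Fin t₂ → (MvPolynomial (Fin 4) k ⧸ Ideal.span {(KLocCellKit.evalL k (T11Char7Poly.G σ))})) (hw₂ : ∀ j : Fin t₂, w₂ j ∈ ((Ideal.span {x | x ∈ (T11Char3Poly.HS σ).map (KLocCellKit.evalL k)}).map (Ideal.Quotient.mk (Ideal.span {(KLocCellKit.evalL k (T11Char7Poly.G σ))})))),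
        (HomogeneousIdeal.irrelevant (reesGrading ((Ideal.span {x | x ∈ (T11Char3Poly.HS σ).map (KLocCellKit.evalL k)}).map (Ideal.Quotient.mk (Ideal.span {(KLocCellKit.evalL k (T11Char7Poly.G σ))}))))).toIdeal ≤
          (Ideal.span (Set.range fun j : Fin t₂ => reesT (I := ((Ideal.span {x | x ∈ (T11Char3Poly.HS σ).map (KLocCellKit.evalL k)}).map (Ideal.Quotient.mk (Ideal.span {(KLocCellKit.evalL k (T11Char7Poly.G σ))})))) (w₂ j) (hw₂ j))).radical ∧
        (∀ j : Fin t₂, w₂ j ≠ 0) ∧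
        ∀ (j : Fin t₂) (Q : Ideal (blowupAlgebra ((Ideal.span {x | x ∈ (T11Char3Poly.HS σ).map (KLocCellKit.evalL k)}).map (Ideal.Quotient.mk (Ideal.span {(KLocCellKit.evalL k (T11Char7Poly.G σ))}))) (w₂ j))) [Q.IsMaximal],
          algebraMap (MvPolynomial (Fin 4) k ⧸ Ideal.span {(KLocCellKit.evalL k (T11Char7Poly.G σ))}) (blowupAlgebra ((Ideal.span {x | x ∈ (T11Char3Poly.HS σ).map (KLocCellKit.evalL k)}).map (Ideal.Quotient.mk (Ideal.span {(KLocCellKit.evalL k (T11Char7Poly.G σ))}))) (w₂ j)) (w₂ j) ∈ Q →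
          ∀ dd : ℕ, ringKrullDim (Localization.AtPrime Q) = dd → ∀ s : Fin dd → Localization.AtPrime Q,
          (Ideal.span (Set.range s)).radical.IsMaximal →
            RingTheory.Sequence.IsWeaklyRegular (Localization.AtPrime Q) (List.ofFn s) ∧
            ∀ y : Localization.AtPrime Q, (∃ e : ℕ, y ^ 3 ^ e ∈ Ideal.span
              ((fun z : Localization.AtPrime Q => z ^ 3 ^ e) ''
                (Ideal.span (Set.range s) : Set (Localization.AtPrime Q)))) → y ∈ Ideal.span (Set.range s) := by
    rintro ⟨c, hc⟩
    rcases (Set.mem_insert_iff.mp hc) with rfl | hc'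
    · exact hblock64
    · rw [Set.mem_singleton_iff] at hc'
      subst hc'
      exact hblock66
  -- the road frame, both levels on the models
  exact TwoLevelRoadFrame.pointFixable_of_chartModels₂ 3 (MvPolynomial (Fin 4) k ⧸ Ideal.span {f}) (Ideal.span ((fun e : Fin 4 →₀ ℕ => Ideal.Quotient.mk (Ideal.span {f}) (monomial e (1 : k))) '' (T11Char7Fan.A : Set (Fin 4 →₀ ℕ)))) hI0 _ hbmax hIb 87
    (fun c => (Ideal.Quotient.mk (Ideal.span {f}) (monomial (T11Char7Fan.m c) (1 : k)))) (fun c => (Ideal.subset_span ⟨T11Char7Fan.m c, T11Char7Fan.hmA c, rfl⟩ : (Ideal.Quotient.mk (Ideal.span {f}) (monomial (T11Char7Fan.m c) (1 : k))) ∈ (Ideal.span ((fun e : Fin 4 →₀ ℕ => Ideal.Quotient.mk (Ideal.span {f}) (monomial e (1 : k))) '' (T11Char7Fan.A : Set (Fin 4 →₀ ℕ)))))) hw0 hcover e he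
    (fun c => (MvPolynomial (Fin 4) k ⧸ Ideal.span {(KLocCellKit.evalL k (T11Char7Poly.G c))})) (fun c => RingEquiv.ofBijective (θ₀ c) (hbij c)) ξ hξ
    (fun c => (if T11Char3Poly.SSoff c = [] then ⊤ else ((Ideal.span {x | x ∈ (T11Char3Poly.HS c).map (KLocCellKit.evalL k)}).map (Ideal.Quotient.mk (Ideal.span {(KLocCellKit.evalL k (T11Char7Poly.G c))}))))) hP'' (fun c => (Ideal.span (Set.range fun j : Fin 4 => Ideal.Quotient.mk (Ideal.span {(KLocCellKit.evalL k (T11Char7Poly.G c))}) (aeval (fun j : Fin 4 => ∏ i : Fin 4, (X i : MvPolynomial (Fin 4) k) ^ T11Char7Fan.V c i j) (X j : MvPolynomial (Fin 4) k))))) h𝔟'' hmodel ({64, 66} : Set (Fin 87)) hSc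
    (fun σ => ((Ideal.span {x | x ∈ (T11Char3Poly.HS σ).map (KLocCellKit.evalL k)}).map (Ideal.Quotient.mk (Ideal.span {(KLocCellKit.evalL k (T11Char7Poly.G σ))})))) hI₂ hblock


end Summit.ResolutionOfSingularities.ResolutionOfSingularities.Theorems.FInjectiveMacaulayfication.T11Char3Frame

end
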